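import Summits.BirchSwinnertonDyer.BirchSwinnertonDyer.Theorems.KolyvaginDepthDoorDepthTableRowsExactReading944e1
import Summits.BirchSwinnertonDyer.BirchSwinnertonDyer.Theorems.Rank2Observatory944e1TwoDescRankTwo
import HarnessLib

/-!
# Route `KolyvaginDepthDoor`, crux `KolyvaginDepthSupplyKN` (stmt-BirchSwinnertonDyer-22820) —
# DEPTH TABLE v11: row `944e1` at `(p, d_K) = (5, −31)` with the `rank E(ℚ) = 2` conjunct
# DISCHARGED by the tree's kernel 2-descent certificate

Helper file of the lead prover of line `levelone` (kdd-p1 g15; `--supports stmt-BirchSwinnertonDyer-22820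
--as helper`); it closes nothing and BSD is not proved by it.

The v10 row `C944e1.exactRow_5_neg31` (g14, file `KolyvaginDepthDoorDepthTableRowsExactReading944e1`) reads this rank-2 depth-table row EXACTLY, for ANY
imaginary quadratic `K` with `d_K = −31`: «∃ frame, Kolyvagin prime `ℓ`, datum: `c_1(ℓ) ≠ 0`» `↔`
«`rank E(ℚ) = 2` ∧ `Ш(E/ℚ)[5] = 0` ∧ `#Sel_5(E^{(−31)}/ℚ) ≤ 5`» — the lower bound `2 ≤ rank` being a
kernel certificate and the upper bound left inside the statement. The tree HOLDS `rank E(ℚ) = 2` for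
`944e1` as a kernel theorem: `Rank2Observatory.C944e1.mordellWeilRank_eq_two` (general 2-descent over
the cubic `2`-division field — Cassels' `x − θ` map into `K(S,2)`, norm-square-residue and real-place
sieves, `decide` only; file `Rank2Observatory944e1TwoDescRankTwo`, accepted 2026-08-21; at the time of
writing its olean was not yet built on the hub, which is why g14 left the rank in the answer). Feeding it
in removes the rank:

* `exactRow_5_neg31_rankFree` — «∃ frame, Kolyvagin prime `ℓ`, datum of conductor `ℓ` with `c_1(ℓ) ≠ 0`» `↔`
  «`Ш(E/ℚ)[5] = 0` ∧ `#Sel_5(E^{(−31)}/ℚ) ≤ 5`» (♠ (2)-residual: N = 2⁴·59; `5` split).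

ONE COMPUTED BIT (Jetchev–Lauter–Stein's algorithm) is EXACTLY «`Ш(E)[5] = 0` and the Heegner twist's
`5`-Selmer group has order `≤ 5`», with no rank, no `hF`, no twist point, no twist pinning and no
`Ш`-hypothesis left in the statement; every per-curve side condition is a kernel theorem of the tree.
CONDITIONAL on the named print facts (γ), Castella–Sano Thm. 3, Zanarella 2.18, Howard–Zanarella, modularity and Mazur 1978 Cor. 4.1; per curve; BSD is NOT proved by it.

References: [WZhang2014] Lemma 8.4 (1) (p. 236), Thm. 9.1 (p. 240); [CastellaSano2026] Thm. 3;
[GrossLMS1991] Prop. 3.7 (2); [JetchevLauterStein2009] §3.6 (arXiv:0707.0032);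
[Cassels1991LecturesEllipticCurves] §15; [CremonaAlgorithms1997] Table 1 (944e1), §3.6.
-/

set_option linter.dupNamespace false

noncomputable section

open scoped Classical NumberField

namespace Summit.BirchSwinnertonDyer.BirchSwinnertonDyer.Theorems.KolyvaginDepthDoor

open Literature.NumberTheory.EllipticCurves Literature.NumberTheory.EllipticCurves.ModularForms
  WeierstrassCurve NumberField IsDedekindDomain
open Summit.BirchSwinnertonDyer.BirchSwinnertonDyer.Theorems
open Summit.BirchSwinnertonDyer.BirchSwinnertonDyer.Rank2Observatory

/-! ## `944e1 = [0, 0, 0, -19, 34]` at `(p, d_K) = (5, -31)` (♠ (2)-residual: N = 2⁴·59; `5` split) -/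

namespace C944e1

/-- **DEPTH-TABLE ROW `944e1`, `(p, d_K) = (5, −31)`, v11 — RANK DISCHARGED.** For `E = 944e1` and ANY
imaginary quadratic `K` with `d_K = −31`: «some frame, some Kolyvagin prime `ℓ`, some datum of conductor `ℓ`
with `c_1(ℓ) ≠ 0`» `↔` «`Ш(E/ℚ)[5] = 0` ∧ `#Sel_5(E^{(−31)}/ℚ) ≤ 5`». From the v10 row `C944e1.exactRow_5_neg31`
(answer `rank = 2 ∧ …`) and the tree's kernel 2-descent certificate
`Rank2Observatory.C944e1.mordellWeilRank_eq_two`. Every side condition is a kernel theorem; CONDITIONAL on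
(γ), Castella–Sano Thm. 3, Zanarella 2.18, Howard–Zanarella, modularity and Mazur 1978 Cor. 4.1 by name; per curve; BSD is not proved by it.
[cite: CastellaSano2026, Thm. 3] [cite: Zanarella2019, Prop. 2.18] [cite: Howard2004, Lemma 1.6.4] [cite: Mazur1978, Cor. 4.1] [cite: GrossLMS1991, Prop. 3.7 (2)]
[cite: Cassels1991LecturesEllipticCurves, §15] [cite: CremonaAlgorithms1997, Table 1 (944e1), §3.6] -/
theorem exactRow_5_neg31_rankFree
    (h372 : GrossLMS1991.prop37_2_frobeniusCongruence)
    (h3 : Literature.NumberTheory.EllipticCurves.CastellaSano2026_kolyvaginClass_selmerDivisibility_eq_padicValNat_tamagawaProduct)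
    (hZ : Literature.NumberTheory.EllipticCurves.Zanarella2019_kolyvaginClass_one_ne_zero_of_not_selmerDivisible)
    (hHZ : Literature.NumberTheory.EllipticCurves.HowardZanarella_exists_minimal_kolyvaginClass_one_selmerCard_of_ne_zero)
    (hnf : exists_isNewformOf) (hMaz : mazur_not_dvd_maninConstant_of_odd)
    (K : Type) [Field K] [NumberField K] (hK : IsImaginaryQuadratic K)
    (hD : NumberField.discr K = -31) :
    haveI := isElliptic_c944e1;
    haveI := isGloballyMinimal_c944e1;
    haveI : NeZero (((⟨0, 0, 0, -19, 34⟩ : WeierstrassCurve ℤ).map (Int.castRingHom ℚ)).conductorNorm ℤ) := neZero_conductorNorm_of_isElliptic _;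
    haveI := Fact.mk (by norm_num : Nat.Prime 5);
    (∃ (Dt : ModularParametrizationData ((⟨0, 0, 0, -19, 34⟩ : WeierstrassCurve ℤ).map (Int.castRingHom ℚ)) (((⟨0, 0, 0, -19, 34⟩ : WeierstrassCurve ℤ).map (Int.castRingHom ℚ)).conductorNorm ℤ)) (β : ℤ)
      (ι : K →+* ℂ) (ℓ : ℕ) (d : KolyvaginHeegnerData Dt β ι ℓ),
      ℓ.Prime ∧ Zhang2014.IsKolyvaginPrime (((⟨0, 0, 0, -19, 34⟩ : WeierstrassCurve ℤ).map (Int.castRingHom ℚ)).conductorNorm ℤ) ((⟨0, 0, 0, -19, 34⟩ : WeierstrassCurve ℤ).map (Int.castRingHom ℚ)) K 5 ℓ ∧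
        d.kolyvaginClass (p := 5) (by norm_num) 1 ≠ 0) ↔
    ((((⟨0, 0, 0, -19, 34⟩ : WeierstrassCurve ℤ).map (Int.castRingHom ℚ)).sha ⊓ AddSubgroup.torsionBy ((⟨0, 0, 0, -19, 34⟩ : WeierstrassCurve ℤ).map (Int.castRingHom ℚ)).galH1 ((5 : ℕ) : ℤ) : AddSubgroup _) = ⊥ ∧
      Nat.card ((((⟨0, 0, 0, -19, 34⟩ : WeierstrassCurve ℤ).map (Int.castRingHom ℚ)).quadraticTwist (NumberField.discr K : ℚ)).selmerGroup (5 : ℕ)) ≤ 5) := by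
  haveI := isElliptic_c944e1
  haveI := isGloballyMinimal_c944e1
  haveI : NeZero (((⟨0, 0, 0, -19, 34⟩ : WeierstrassCurve ℤ).map (Int.castRingHom ℚ)).conductorNorm ℤ) := neZero_conductorNorm_of_isElliptic _
  haveI := Fact.mk (by norm_num : Nat.Prime 5)
  exact (exactRow_5_neg31 h372 h3 hZ hHZ hnf hMaz K hK hD).trans
    (and_iff_right Summit.BirchSwinnertonDyer.BirchSwinnertonDyer.Rank2Observatory.C944e1.mordellWeilRank_eq_two)

end C944e1

end Summit.BirchSwinnertonDyer.BirchSwinnertonDyer.Theorems.KolyvaginDepthDoor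

end
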